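import Summits.HodgeConjecture.HodgeConjecture.Theorems.R90S6BCGraphPartner           -- ★ W7-b (ii): `bcGraphPartnerAlgHom` (= ψ̂_G), `graph_bcGraphPartnerAlgHom` (brings ★ GL Satake `IsIwasawaExponent.satakeTransform`, `isIwasawaExponent_gl`)
import Summits.HodgeConjecture.HodgeConjecture.Theorems.R90S6SatakeCoeffGraphPartner  -- ★ B3: `prod_zpow_param_three` (brings ★ `eq_of_forall_laurentEvalAt_eq`, ★ `coeff_satakeTransform_eq_zero_of_ne_neg`, ★ `eq_linear_three_of_rev`)
import HarnessLib

/-!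
# R90 · S6 «Ch. 14.1–14.5 stable trace formula» — card TB3 (DAG rows E1.4.4.2.1 ∕ E1.4.4.2.3, hyperbolic half): SATAKE COEFFICIENTS OF THE BASE-CHANGE PARTNER
# ON THE NORM FIBRE — `(𝒮(ψ̂_G φ))_{ℓ_k} = Σ_{μ : μ₀ − μ₂ = k} (𝒮^{GL}_{wt} φ)_μ` for all `k ∈ ℤ` (`Theorems/R90S6SatakeCoeffBCPartner.lean`)

Cell `hodgecm-mathlib`, crux H413 (`stmt-HodgeConjecture-24833`), route of record `HCCMUnconditional`; programme R90-TF (brief `director/R90-BRIEF.v2.md`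
1f40d54518340a35), section S6 (base `R90-C14`, dealer R90-C14-plan (g2)), seat R90-C14-p04 (g2); CARD TB3 dealt BY NAME 2026-09-05T01:27:34Z (R90 bus), the
TWISTED TWIN of ★ B3 `R90S6SatakeCoeffGraphPartner` (`ξ̂_H`).  Lane `--kind proof --supports stmt-HodgeConjecture-24833 --as helper`; THEOREMS ONLY over ★ `Theorems` ∕
Literature ∕ Mathlib carriers (no definition, no instance, no notation, no named fact, no kit, no `sorry`).

## THE PRINT
[Rogawski1990, §4.10 Prop. 4.10.1 (a), Prop. 4.10.2 pp. 57–58]: `ψ̂_G : ℋ(G̃, ω̃) → ℋ(G, ω)` is characterised by `Tr(π̃(φ)π̃(ε)) = Tr(i_G(χ)(ψ̂_G φ))`, `π̃ = i_{G̃}(χ ∘ N)`;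
«if `δ = d(x, y, z′) ∈ M̃`, then `γ = d(x∕z̄′, y∕ȳ, z′∕x̄)`», so `χ_z ∘ N` has `GL₃`-parameter `(z, 1, z⁻¹)`: the tree's ★ W7-b `bcGraphPartnerAlgHom` IS this map, DEFINED by
its graph `λ^{GL₃}_{(z,1,z⁻¹)}(φ) = λ^{U(3)}_{(z,1,1)}(ψ̂_G φ)` (★ `graph_bcGraphPartnerAlgHom`).  [CartierCorvallis1979, §IV (4.2)–(4.4)]: `λ_β(f) = (𝒮f)(β)`.  On
exponents the norm `N(diag ϖ^μ) = diag(ϖ^{μ₀−μ₂}, 1, ϖ^{μ₂−μ₀})` (antidiagonal twist) is `μ ↦ μ₀ − μ₂`: the parameter `(z, 1, z⁻¹)` evaluates `x^μ ↦ z^{μ₀−μ₂}`, so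
`λ^{GL₃}_{(z,1,z⁻¹)}(φ) = Σ_k (Σ_{μ₀−μ₂ = k} (𝒮^{GL} φ)_μ) z^k` — the RESTRICTION OF THE `GL₃` SATAKE POLYNOMIAL TO THE BASE-CHANGE LINE is the NORM-FIBRE SUM pushed onto the
`U(3)` line `ℓ_k = (k, 0, −k)`; comparing with `λ^{U(3)}_{(z,1,1)}(ψ̂_Gφ) = Σ_k (𝒮(ψ̂_Gφ))_{ℓ_k} z^k` coefficient by coefficient gives the HEAD.  Both Satake transforms carry their
`δ^{1∕2}`-weights INSIDE (`wt` on the `GL` side — hypothesis `hwt` of ★ W7-b; `satakeWeight (residueCardSqrt E_w)` on the `U` side), so the identity carries no extra factor.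

## WHAT IS PROVED
* §1 (generic `ℂ[ℤ³]`): **`laurentEvalAt_bcLine_eq_laurentEvalAt_normFibre`** — for EVERY `P ∈ ℂ[ℤ³]`:
  `ev_{(z,1,z⁻¹)}(P) = ev_{(z,1,1)}(Σ_{μ ∈ supp P} x^{ℓ_{μ₀−μ₂}} · P_μ)` (the BC line = the norm fibre-sum on the `U(3)` line), and **`laurentEvalAt_eq_laurentEvalAt_line_three`** — an
  element supported on the `U(3)` line `ℓ_k` is evaluated at `β = (β₀, β₁, β₂)` exactly as at `(β₀β₂⁻¹, 1, 1)` (B3's (B3.1′) twin at rank one of `U(3)`).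
* §2 (adic place `w ∣ v` inert, `E_w∕F_v` unramified; `U`-binders `c hc1 v w hw hv` = ★ W3, ANY datum `hd`; `GL`-binders = ★ W7-b (ii) VERBATIM): HEAD
  **`coeff_satakeTransform_bcGraphPartner`**: for every `φ ∈ ℋ(GL₃(K), GL₃(𝒪))` and every `k ∈ ℤ`,
  `(hd.satakeTransform (ψ̂_G φ))_{ℓ_k} = Σ_{μ ∈ supp(𝒮^{GL}_{wt} φ), μ₀ − μ₂ = k} (𝒮^{GL}_{wt} φ)_μ` (`Finset.filter` over the support).  Proof: the graph (★) says `ev_{(z,1,1)}` of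
  `𝒮(ψ̂_Gφ)` and of the norm-fibre transport `G` of `𝒮^{GL}φ` agree for all `z`; both are supported on the line, so they agree on `(ℂˣ)³` (§1) and are EQUAL (★
  `eq_of_forall_laurentEvalAt_eq`); read off the coefficient at `ℓ_k`.
HONEST LABEL: local Hecke coefficient algebra over ★ carriers; proves no printed global statement and no orbital-integral identity (the twisted FL `φ ↦ ψ̂_G φ` stays
FLOOR `StubR90ExtE1TwistedTransferFL`), discharges no citation; count-neutral helper until row E1.4.4.2.3 (hyperbolic half of `TO^{st}_{δε}(φ) = SO_{Nδ}(ψ̂_Gφ)`) consumes it.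
HC_CM is proved only modulo the 7 printed citations (2 remaining named inputs: hLiu418 = stmt-HodgeConjecture-24832, h413 = stmt-HodgeConjecture-24833) until rung 0
closes; REL ≠ ★ ≠ BUILT.

## Tree search (dedup)
`rg "SatakeCoeffBCPartner|coeff_satakeTransform_bcGraphPartner|laurentEvalAt_bcLine|laurentEvalAt_eq_laurentEvalAt_line_three|laurentEvalAt_normFibre"` over `lean/` — no hit
(the bare token `normFibre` also names ★ `Rogawski1990/LocalNormFibre*` — the norm-fibre TORUS files of the unit estate, unrelated objects) (2026-09-05T01:29Z);
REUSED ★: `graph_bcGraphPartnerAlgHom` [R90S6BCGraphPartner :236], `eq_of_forall_laurentEvalAt_eq` [UnramifiedEigencharactersSeparate :132], B3 `prod_zpow_param_three`,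
`coeff_satakeTransform_eq_zero_of_ne_neg`, `eq_linear_three_of_rev`, `unitaryHeckeEigencharacterAdic_eq`, `heckeEigencharacter_apply` (U and GL).

## References
* [Rogawski1990] J. D. Rogawski, *Automorphic Representations of Unitary Groups in Three Variables*, Ann. of Math. Stud. 123 (1990): §4.10 Prop. 4.10.1 (a), Prop. 4.10.2
  pp. 57–58; §4.7 p. 51 (`ψ_G`).
* [CartierCorvallis1979] P. Cartier, *Representations of 𝔭-adic groups: a survey*, PSPM 33.1 (1979): §IV (4.2)–(4.4), Thm. 4.1, Cor. 4.2.
* [Kottwitz1986BaseChangeUnits] R. E. Kottwitz, *Base change for unit elements of Hecke algebras*, Compositio Math. 60 (1986): §1 pp. 239–243.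
-/

set_option autoImplicit false
-- the mandated namespace repeats the single-problem summit's segment (`HodgeConjecture.HodgeConjecture`)
set_option linter.dupNamespace false

noncomputable section

open scoped Valued WithZero Matrix MatrixGroups
open NumberField IsDedekindDomain ValuativeRel
open Literature.NumberTheory.Automorphic Literature.NumberTheory.Automorphic.HermitianLattice Literature.NumberTheory.Automorphic.UnitaryGroup

namespace Summit.HodgeConjecture.HodgeConjecture.R90.S6

universe u

/-! ## §1 The base-change line of `ℂ[ℤ³]` is the norm fibre-sum on the `U(3)` line -/

section Line

/-- **`ev_{(z,1,z⁻¹)}(P) = ev_{(z,1,1)}(Σ_{μ ∈ supp P} x^{ℓ_{μ₀−μ₂}}·P_μ)` for every `P ∈ ℂ[ℤ³]`**: on exponents the base-change parameter `(z, 1, z⁻¹)` reads `x^μ ↦ z^{μ₀−μ₂}`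
(the norm map `μ ↦ μ₀ − μ₂` of the antidiagonal twist), so restricting a `GL₃` Laurent polynomial to the base-change line is pushing its NORM-FIBRE SUMS onto the `U(3)`
line `ℓ_k = (k, 0, −k)` and evaluating at `(z, 1, 1)` (★ B3 `prod_zpow_param_three`). [cite: Rogawski1990, §4.10 Prop. 4.10.2 p. 58] [cite: CartierCorvallis1979, §IV (4.2)] -/
theorem laurentEvalAt_bcLine_eq_laurentEvalAt_normFibre (P : AddMonoidAlgebra ℂ (Fin 3 → ℤ)) (z : ℂˣ) :
    laurentEvalAt ![z, 1, z⁻¹] P =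
      laurentEvalAt ![z, 1, 1] (∑ μ ∈ P.coeff.support,
        AddMonoidAlgebra.single (fun i : Fin 3 => (μ 0 - μ 2) * (1 - ((i : ℕ) : ℤ))) (P.coeff μ)) := by
  classical
  conv_lhs => rw [← AddMonoidAlgebra.sum_coeff_single P, map_finsuppSum, Finsupp.sum]
  rw [map_sum]
  refine Finset.sum_congr rfl fun μ _ => ?_
  rw [laurentEvalAt_single, laurentEvalAt_single, prod_zpow_param_three, Fin.prod_univ_three]
  simp only [Fin.isValue, Fin.val_zero, Nat.cast_zero, sub_zero, mul_one, Matrix.cons_val_zero, Matrix.cons_val_one, Matrix.cons_val_two,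
    Matrix.tail_cons, Matrix.head_cons, Units.val_one, one_zpow, Units.val_inv_eq_inv_val, inv_zpow', zpow_sub₀ (Units.ne_zero z), div_eq_mul_inv,
    zpow_neg]

/-- **A line-supported element of `ℂ[ℤ³]` only sees `β₀β₂⁻¹`**: if `H` is supported on the `U(3)` line `ℓ_k = (k, 0, −k)` then
`ev_β(H) = ev_{(β₀β₂⁻¹, 1, 1)}(H)` for every `β ∈ (ℂˣ)³` (`β₀^k β₁^0 β₂^{−k} = (β₀β₂⁻¹)^k`) — so two line-supported elements agreeing on the line `{(z,1,1)}` agree on `(ℂˣ)³`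
and are equal by ★ `eq_of_forall_laurentEvalAt_eq` (★ B3 `laurentEvalAt_eq_laurentEvalAt_line_two` is the `U(1,1)` twin). [cite: CartierCorvallis1979, §IV (4.2)–(4.4), Cor. 4.2] -/
theorem laurentEvalAt_eq_laurentEvalAt_line_three (H : AddMonoidAlgebra ℂ (Fin 3 → ℤ))
    (hH : ∀ μ, H.coeff μ ≠ 0 → μ = fun i : Fin 3 => μ 0 * (1 - ((i : ℕ) : ℤ))) (β : Fin 3 → ℂˣ) :
    laurentEvalAt β H = laurentEvalAt ![β 0 * (β 2)⁻¹, 1, 1] H := by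
  classical
  conv_lhs => rw [← AddMonoidAlgebra.sum_coeff_single H, map_finsuppSum, Finsupp.sum]
  conv_rhs => rw [← AddMonoidAlgebra.sum_coeff_single H, map_finsuppSum, Finsupp.sum]
  refine Finset.sum_congr rfl fun μ hμ => ?_
  rw [laurentEvalAt_single, laurentEvalAt_single, hH μ (Finsupp.mem_support_iff.1 hμ), Fin.prod_univ_three, Fin.prod_univ_three]
  simp only [Fin.isValue, Fin.val_zero, Fin.val_one, Fin.val_two, Nat.cast_zero, Nat.cast_one, Nat.cast_ofNat, mul_zero, sub_zero, mul_one, sub_self,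
    zpow_zero, Matrix.cons_val_zero, Matrix.cons_val_one, Matrix.cons_val_two, Matrix.tail_cons, Matrix.head_cons, Units.val_one, one_zpow,
    Units.val_mul, Units.val_inv_eq_inv_val, mul_zpow, inv_zpow', show (1 : ℤ) - 2 = -1 by norm_num, mul_neg, mul_one, zpow_neg, inv_one]

end Line

/-! ## §2 The Satake coefficients of `ψ̂_G φ` are the norm-fibre sums of the `GL₃` Satake coefficients of `φ` -/

section Adic

variable {F E : Type} [Field F] [NumberField F] [Field E] [NumberField E] [Algebra F E] [Algebra.IsQuadraticExtension F E]
  (c : E ≃ₐ[F] E) (hc1 : c ≠ 1) (v : HeightOneSpectrum (𝓞 F)) (w : PlacesOver E v) (hw : c • w.1 = w.1)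
  (hv : Algebra.IsUnramifiedIn (𝓞 E) v.asIdeal)
  {K : Type u} [Field K] [ValuativeRel K] [IsDiscreteValuationRing 𝒪[K]] [Finite 𝓀[K]] {ϖ : K}
  [IsHeckeTriple (⊤ : Submonoid (GL (Fin 3) K)) (glInt 3 K) (glInt 3 K)]
  (hϖ : IsUniformizingElement ϖ) {u : ℂˣ} (hu : (u : ℂ) ^ 2 = ((Nat.card 𝓀[K] : ℕ) : ℂ))
  {wt : Multiplicative (Fin 3 → ℤ) →* ℂ}
  (hwt : ∀ e : Fin 3 → ℤ, wt (Multiplicative.ofAdd e) = ((u ^ ((((3 : ℕ) : ℤ) - 1) * (∑ i, e i) - 2 * satakeTwistExp e) : ℂˣ) : ℂ))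

-- (raised heartbeat budget: the adic `heckeAlgebra` carrier at `E_w` vs the generic-`K` carrier of the ★ Satake files agree only up to instance-path unfolding; each such
--  unification is costly — as in ★ W3-a `satakeGraph_partner_exists` and ★ B3; 400000 measured insufficient there; no `decide`, no search)
set_option maxHeartbeats 800000 in
/-- **TB3 HEAD — SATAKE COEFFICIENTS OF THE BASE-CHANGE PARTNER ON THE NORM FIBRE.**  At an inert place `w ∣ v` with `E_w∕F_v` unramified, for every
`φ ∈ ℋ(GL₃(K), GL₃(𝒪))` (the `GL`-side over any DVR field `K` with the `δ^{1∕2}`-weight `wt` of ★ W7-b), every unramified datum `hd` at `w` and every `k ∈ ℤ`: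
`(𝒮(ψ̂_G φ))_{ℓ_k} = Σ_{μ ∈ supp(𝒮^{GL}_{wt} φ), μ₀ − μ₂ = k} (𝒮^{GL}_{wt} φ)_μ` — the `U(3)` Satake coefficient of the base-change partner at `ℓ_k = (k, 0, −k)` is the sum of the
`GL₃` Satake coefficients over the NORM FIBRE `{μ : μ₀ − μ₂ = k}`.  Proof: ★ `graph_bcGraphPartnerAlgHom` read through `laurentEvalAt` (GL side by `rfl`, U side by ★
`unitaryHeckeEigencharacterAdic_eq` + ★ `heckeEigencharacter_apply`) + §1 + ★ `eq_of_forall_laurentEvalAt_eq`, then the coefficient at `ℓ_k`.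
[cite: Rogawski1990, §4.10 Prop. 4.10.1 (a), Prop. 4.10.2 pp. 57–58] [cite: CartierCorvallis1979, §IV (4.2)–(4.4), Thm. 4.1, Cor. 4.2] [cite: Kottwitz1986BaseChangeUnits, §1 pp. 239–243] -/
theorem coeff_satakeTransform_bcGraphPartner {ϖE : w.1.adicCompletion E}
    (hd : UnramifiedLocalConjDatum (galAdicCompletionMap (L := E) c hw) ϖE) (φ : heckeAlgebra ℂ (GL (Fin 3) K) (glInt 3 K)) (k : ℤ) :
    (hd.satakeTransform (bcGraphPartnerAlgHom c hc1 v w hw hv hϖ hu hwt φ)).coeff (fun i : Fin 3 => k * (1 - ((i : ℕ) : ℤ))) =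
      ∑ μ ∈ ((isIwasawaExponent_gl (n := 3) hϖ).satakeTransform wt φ).coeff.support with μ 0 - μ 2 = k,
        ((isIwasawaExponent_gl (n := 3) hϖ).satakeTransform wt φ).coeff μ := by
  classical
  haveI := finite_residueField_adicCompletion E w.1
  set P := (isIwasawaExponent_gl (n := 3) hϖ).satakeTransform wt φ with hP
  set F₃ := hd.satakeTransform (bcGraphPartnerAlgHom c hc1 v w hw hv hϖ hu hwt φ) with hF₃
  -- the `U(3)` Satake transform is supported on the line `ℓ_k`
  have hanti : ∀ μ, F₃.coeff μ ≠ 0 → μ = fun i : Fin 3 => μ 0 * (1 - ((i : ℕ) : ℤ)) := fun μ hμ =>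
    eq_linear_three_of_rev μ fun i => by
      by_contra hne
      exact hμ (hd.coeff_satakeTransform_eq_zero_of_ne_neg _ hne)
  -- the norm-fibre transport of the `GL₃` Satake polynomial onto the `U(3)` line
  set G : AddMonoidAlgebra ℂ (Fin 3 → ℤ) :=
    ∑ μ ∈ P.coeff.support, AddMonoidAlgebra.single (fun i : Fin 3 => (μ 0 - μ 2) * (1 - ((i : ℕ) : ℤ))) (P.coeff μ) with hG
  have hsuppG : ∀ ν, G.coeff ν ≠ 0 → ν = fun i : Fin 3 => ν 0 * (1 - ((i : ℕ) : ℤ)) := by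
    intro ν hν
    rw [hG, AddMonoidAlgebra.coeff_sum, Finsupp.finsetSum_apply] at hν
    obtain ⟨μ, -, hμν⟩ := Finset.exists_ne_zero_of_sum_ne_zero hν
    rw [AddMonoidAlgebra.coeff_single, Finsupp.single_apply] at hμν
    split_ifs at hμν with hμ
    · rw [← hμ]
      funext i
      simp only [Fin.isValue, Fin.val_zero, Nat.cast_zero, sub_zero, mul_one]
    · exact absurd rfl hμν
  -- the graph identity: `ev_{(z,1,1)} F₃ = ev_{(z,1,z⁻¹)} P = ev_{(z,1,1)} G`
  have hgraph : ∀ z : ℂˣ, laurentEvalAt ![z, 1, 1] F₃ = laurentEvalAt ![z, 1, 1] G := by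
    intro z
    have hg := graph_bcGraphPartnerAlgHom c hc1 v w hw hv hϖ hu hwt φ z
    rw [unitaryHeckeEigencharacterAdic_eq c hc1 v w hw hv hd, hd.heckeEigencharacter_apply,
      (isIwasawaExponent_gl (n := 3) hϖ).heckeEigencharacter_apply] at hg
    -- the GL side IS `laurentEvalAt ![z,1,z⁻¹] P` (definition of `laurentEvalAt`)
    rw [hG, ← laurentEvalAt_bcLine_eq_laurentEvalAt_normFibre P z]
    exact hg.symm
  -- hence `F₃ = G`
  have hFG : F₃ = G :=
    eq_of_forall_laurentEvalAt_eq fun β => by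
      rw [laurentEvalAt_eq_laurentEvalAt_line_three F₃ hanti β, laurentEvalAt_eq_laurentEvalAt_line_three G hsuppG β, hgraph]
  -- read off the coefficient at `ℓ_k`
  rw [hFG, hG, AddMonoidAlgebra.coeff_sum, Finsupp.finsetSum_apply, Finset.sum_filter]
  refine Finset.sum_congr rfl fun μ _ => ?_
  rw [AddMonoidAlgebra.coeff_single, Finsupp.single_apply]
  by_cases hk : μ 0 - μ 2 = k
  · rw [if_pos (by rw [hk]), if_pos hk]
  · rw [if_neg hk, if_neg]
    intro h
    apply hk
    have h0 := congrFun h 0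
    simpa using h0

end Adic

end Summit.HodgeConjecture.HodgeConjecture.R90.S6

end
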